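import Literature.NumberTheory.EllipticCurves.KodairaNeronMultiplicativeProofs
import Literature.NumberTheory.EllipticCurves.HasseWeilAbelianEulerFactorKodairaNeronProofs
import Literature.NumberTheory.EllipticCurves.InertiaInvariantsMultiplicativeProofs
import Literature.NumberTheory.GaloisRepresentations.FrobeniusGeneration
import HarnessLib

/-!
# `D_𝔓` acts on `(V_ℓ E)^{I_𝔓}` through the cyclotomic character at a split multiplicative place:
# discharge of `smul_fixedSubmodule_inertia_rationalTate_of_hasSplitMultiplicativeReductionAt`

Proof file (theorems only, no definitions, no named facts) in topic `NumberTheory/EllipticCurves`,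
sibling of `HasseWeilAbelianEulerFactorElliptic` and `HasseWeilAbelianEulerFactorEllipticProofs`
(which discharges the non-split companion), discharging the named fact
`WeierstrassCurve.smul_fixedSubmodule_inertia_rationalTate_of_hasSplitMultiplicativeReductionAt W ℓ`
of `HasseWeilAbelianEulerFactorElliptic`: *for an elliptic curve `E/K` over a number field with
split multiplicative reduction at the finite place `v ∤ ℓ` and a prime `𝔓 ∣ v` of `\bar ℤ_K`,
every `σ` in the decomposition group `D_𝔓` acts on the inertia invariants `(V_ℓ E)^{I_𝔓}` as
multiplication by `χ_ℓ(σ)`* (Silverman, *Advanced Topics in the Arithmetic of Elliptic Curves*,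
Exercise 5.13(a),(b), PDF p. 416: for `E/K_v` with split multiplicative reduction there is an
exact sequence of `G_{K̄_v/K_v}`-modules `1 → T_ℓ(μ) → T_ℓ(E) → ℤ_ℓ → 0`, and the inertia group
acts through `(1 b; 0 1)` with `b ≠ 0` allowed, so `T_ℓ(E)^{I} = T_ℓ(μ)`; Serre–Tate, *Good
reduction of abelian varieties*, §1 Lemma 2: the reduction isomorphism `V_ℓ(E)^{I} ≅ V_ℓ(Ẽ_ns(k̄))`
commutes with `D(v̄)`, and `Ẽ_ns ≅ 𝔾_m` over `k_v` at a split node), together with its consequence,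
the split bad-place fact `WeierstrassCurve.inertiaCoinvariants_rationalTate_of_hasSplitMultiplicativeReductionAt W ℓ`
of `HasseWeilAbelianBadReduction` (*`(V_ℓ E)_{I_𝔓}` is a line with trivial `D_𝔓`-action*, the
Galois side of `L_v(E, T) = 1 - T`, Silverman, *AEC*, C.§16).

## The proof

Everything geometric is already a theorem of the tree, **for the arithmetic Frobenius elements**
of `D_𝔓`: by `smul_nsmul_torsion_of_hasMultiplicativeReductionAt_of_kodairaNeron_at`
(`HasseWeilAbelianEulerFactorKodairaNeronProofs`: the explicit `D`-equivariant reduction map onto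
the split node `Ẽ_ns(k̄_v) ≅ k̄_vˣ`, Serre–Tate's Lemmas 1–2 on torsion points) fed with the
Kodaira–Néron finiteness over `K_v^nr` at the multiplicative place
(`kodairaNeron_exists_finset_reducesToNonsingular_of_hasMultiplicativeReductionAt`,
`KodairaNeronMultiplicativeProofs`) — together the torsion fact
`serreTate_frobenius_smul_torsion_of_hasSplitMultiplicativeReductionAt` (also recorded as the
theorem `…_holds` of `HasseWeilAbelianEulerFactorHoldsProofs`) — and
`frobenius_smul_fixedSubmodule_inertia_rationalTate_of_hasSplitMultiplicativeReductionAt_of_frobenius_torsion`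
(`HasseWeilAbelianEulerFactorFrobenius`), an arithmetic Frobenius `φ` at `𝔓` acts on
`(V_ℓ E)^{I_𝔓}` as `N v = χ_ℓ(φ)` (`GaloisRep.toZModPow_cyclotomicCharacter_of_isArithFrobAt`,
Serre, *Abelian `ℓ`-adic representations*, I.1.2).  The passage from Frobenius elements to the
whole decomposition group is the classical fact that `D_𝔓/I_𝔓 ≅ Gal(k̄_v/k_v)` is topologically
generated by Frobenius (Neukirch, *Algebraic Number Theory*, I §9 (9.4)–(9.5); Serre, *Local
Fields*, I §8), in the form proved in the tree
(`Literature.NumberTheory.GaloisRepresentations.exists_eq_frobenius_pow_mul_of_mem_decompositionSubgroup`,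
`FrobeniusGeneration`: for every open subgroup `U ≤ Γ_K`, every `d ∈ D_𝔓` is `φⁿ · i · u` with
`i ∈ I_𝔓`, `u ∈ U`), combined with continuity: for `e ∈ (V_ℓ E)^{I_𝔓}` the set
`S = {g ∈ Γ_K | ρ(g) e = χ_ℓ(g) e}` is closed (the action `Γ_K × V_ℓ E → V_ℓ E` and
`χ_ℓ : Γ_K → ℤ_ℓˣ` are continuous, `V_ℓ E ≅ ℚ_ℓ²` is Hausdorff), closed under multiplication
(scalars commute with `ρ(g)`), contains `I_𝔓` (`ρ(i) e = e` and `χ_ℓ(i) = 1`: the cyclotomic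
character is unramified at `v ∤ ℓ`, `smul_eq_self_of_mem_inertia_of_pow_prime_pow_eq_one`) and
the powers of `φ`; since the cosets `d · Gal(K̄/E)`, `E/K` finite, form a neighbourhood basis of
`d` (Krull topology), `d ∈ \bar S = S`.

Results:

* `Literature.NumberTheory.GaloisRepresentations.GaloisRep.cyclotomicCharacter_eq_one_of_mem_inertia`
  (`χ_ℓ(I_𝔓) = 1` for `𝔓 ∣ v ∤ ℓ`; the value `χ_ℓ(Frob_v) = N v` is read off the congruences
  `GaloisRep.toZModPow_cyclotomicCharacter_of_isArithFrobAt` of `HasseWeilAbelianEulerFactorFrobenius`,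
  the universe-polymorphic form of the tree's `GaloisRep.cyclotomicCharacter_apply_of_isArithFrobAt`);
* `Literature.NumberTheory.GaloisRepresentations.decompositionSubgroup_subset_of_isClosed_of_frobenius_mem`
  (a closed submonoid of `Γ_K` containing `I_𝔓` and an arithmetic Frobenius at `𝔓` contains
  `D_𝔓`), `Literature.NumberTheory.GaloisRepresentations.apply_eq_smul_of_mem_decompositionSubgroup_of_frobenius`
  (an eigenvalue character of `D_𝔓` on a vector is determined by Frobenius and inertia);
* `WeierstrassCurve.frobenius_smul_fixedSubmodule_inertia_rationalTate_of_hasSplitMultiplicativeReductionAt`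
  (an arithmetic Frobenius acts on `(V_ℓ E)^{I_𝔓}` as `N v` at a split multiplicative place —
  unconditionally);
* `WeierstrassCurve.smul_fixedSubmodule_inertia_rationalTate_of_hasSplitMultiplicativeReductionAt_holds`
  (**the discharge**);
* `WeierstrassCurve.inertiaCoinvariants_rationalTate_of_hasSplitMultiplicativeReductionAt_holds`
  (the split bad-place fact of `HasseWeilAbelianBadReduction` is a theorem).

## References

* J. H. Silverman, *Advanced Topics in the Arithmetic of Elliptic Curves*, GTM 151 (1994):
  Exercise 5.13(a),(b) (PDF p. 416), with Thm. V.5.3 (PDF p. 407); Thm. IV.10.2(a) and its proof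
  (PDF pp. 358–359). [SilvermanATAEC1994]
* J.-P. Serre, J. Tate, *Good reduction of abelian varieties*, Ann. of Math. (2) 88 (1968),
  §1 Lemma 1 and Lemma 2 (p. 495). [SerreTate1968]
* J.-P. Serre, *Abelian `ℓ`-adic representations and elliptic curves* (1968), Ch. I §1.2
  (`χ_ℓ` is unramified away from `ℓ`, `χ_ℓ(F_v) = N v`). [SerreAbelianLadic1968]
* J. Neukirch, *Algebraic Number Theory* (1999), Ch. I §9, Prop. (9.4)–(9.5) (`G_𝔓/I_𝔓 ≅
  G(κ(𝔓)|κ(𝔭))`, generated by Frobenius). [NeukirchANT1999]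
* J. H. Silverman, *The Arithmetic of Elliptic Curves*, 2nd ed., GTM 106 (2009): §C.16
  (PDF p. 390). [SilvermanAEC2009]

## Design

Theorems only; one universe `u` (`K : Type u`); deliberate dot-notation extensions of Mathlib's
`WeierstrassCurve` namespace, as in the sibling files; the cyclotomic-character lemma and the two
abstract decomposition-group lemmas (`decompositionSubgroup_subset_of_isClosed_of_frobenius_mem`,
`apply_eq_smul_of_mem_decompositionSubgroup_of_frobenius`) in
`namespace Literature.NumberTheory.GaloisRepresentations`.  Imports: those of
`HasseWeilAbelianEulerFactorHoldsProofs` (`KodairaNeronMultiplicativeProofs`,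
`HasseWeilAbelianEulerFactorKodairaNeronProofs`, `InertiaInvariantsMultiplicativeProofs`) plus
`GaloisRepresentations/FrobeniusGeneration`.  No instances, no `sorry`, no `def`; all axioms
`propext`, `Classical.choice`, `Quot.sound`.
-/

noncomputable section

open scoped NumberField Topology
open Field IsDedekindDomain

universe u

/-! ### The cyclotomic character on inertia elements (universe-polymorphic) -/

namespace Literature.NumberTheory.GaloisRepresentations

variable {K : Type u} [Field K] [NumberField K] (ℓ : ℕ) [Fact ℓ.Prime]

/-- **`χ_ℓ(σ) = 1` for `σ` in an inertia group `I_𝔓`, `𝔓 ∣ v ∤ ℓ`** — the `ℓ`-adic cyclotomic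
character of a number field is unramified away from `ℓ` (Serre, *Abelian `ℓ`-adic
representations*, Ch. I §1.2, Example): `σ` fixes every `ℓ`-power root of unity of `K̄`
(`smul_eq_self_of_mem_inertia_of_pow_prime_pow_eq_one`: roots of unity of order prime to the
residue characteristic stay distinct modulo `𝔓`), hence `χ_ℓ(σ) = 1`
(`cyclotomicCharacter_eq_one_of_forall_pow_eq_one`).  This is the pointwise content of the tree's
`FramedGaloisRep.isUnramifiedAt_cyclotomic_holds`.
[cite: SerreAbelianLadic1968, Ch. I §1.2 (Example: the cyclotomic character)] -/
theorem GaloisRep.cyclotomicCharacter_eq_one_of_mem_inertia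
    {v : HeightOneSpectrum (𝓞 K)} (hv : (ℓ : 𝓞 K) ∉ v.asIdeal)
    {𝔓 : Ideal (absIntegers (𝓞 K) K)} (h𝔓 : 𝔓 ∈ v.primesAbove)
    {σ : absoluteGaloisGroup K} (hσ : σ ∈ 𝔓.inertia (absoluteGaloisGroup K)) :
    GaloisRep.cyclotomicCharacter K ℓ σ = 1 := by
  rw [GaloisRep.cyclotomicCharacter_apply]
  exact cyclotomicCharacter_eq_one_of_forall_pow_eq_one ℓ _ fun _ _ ht ↦
    smul_eq_self_of_mem_inertia_of_pow_prime_pow_eq_one hv h𝔓 hσ ht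

end Literature.NumberTheory.GaloisRepresentations

namespace WeierstrassCurve

open Literature.NumberTheory.EllipticCurves Literature.NumberTheory.GaloisRepresentations

variable {K : Type u} [Field K] [NumberField K] (W : WeierstrassCurve K) (ℓ : ℕ) [Fact ℓ.Prime]

/-! ### Frobenius elements on `(V_ℓ E)^{I_𝔓}` at a split multiplicative place -/

/-- **An arithmetic Frobenius acts on `(V_ℓ E)^{I_𝔓}` as `N v` at a split multiplicative place —
unconditionally.**  For an elliptic curve `E/K` over a number field with split multiplicative
reduction at the finite place `v ∤ ℓ`, a prime `𝔓 ∣ v` of `\bar ℤ_K` and an arithmetic Frobenius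
`σ ∈ Γ_K` at `𝔓`, `σ e = (N v) e` for every `e ∈ (V_ℓ E)^{I_𝔓}` (Silverman, *ATAEC*,
Exercise 5.13(a),(b): `(V_ℓ E)^{I} = V_ℓ(μ)`; Serre I.1.2: `χ_ℓ(F_v) = N v`):
`frobenius_smul_fixedSubmodule_inertia_rationalTate_of_hasSplitMultiplicativeReductionAt_of_frobenius_torsion`
(`HasseWeilAbelianEulerFactorFrobenius`) fed with the torsion fact
`serreTate_frobenius_smul_torsion_of_hasSplitMultiplicativeReductionAt W ℓ` (Serre–Tate §1
Lemmas 1–2 with the split torus), which holds by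
`smul_nsmul_torsion_of_hasMultiplicativeReductionAt_of_kodairaNeron_at` (split branch) and
Kodaira–Néron over `K_v^nr` at the multiplicative place
(`kodairaNeron_exists_finset_reducesToNonsingular_of_hasMultiplicativeReductionAt`; the same three
lines as `serreTate_frobenius_smul_torsion_of_hasSplitMultiplicativeReductionAt_holds` of
`HasseWeilAbelianEulerFactorHoldsProofs`).
[cite: SilvermanATAEC1994, Exercise 5.13(a),(b) (PDF p. 416)]
[cite: SerreTate1968, §1 Lemma 1 and Lemma 2 (p. 495)] -/
theorem frobenius_smul_fixedSubmodule_inertia_rationalTate_of_hasSplitMultiplicativeReductionAt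
    [W.IsElliptic]
    (h : Continuous fun x : absoluteGaloisGroup K × RationalTateModule (geomPoints W) ℓ ↦
      rationalTateRepresentation (absoluteGaloisGroup K) (geomPoints W) ℓ x.1 x.2)
    {v : HeightOneSpectrum (𝓞 K)} (hℓ : (ℓ : 𝓞 K) ∉ v.asIdeal)
    (hv : W.HasSplitMultiplicativeReductionAt v)
    {𝔓 : Ideal (absIntegers (𝓞 K) K)} (h𝔓 : 𝔓 ∈ v.primesAbove)
    {σ : absoluteGaloisGroup K} (hσ : IsArithFrobAt (𝓞 K) σ 𝔓)
    {e : RationalTateModule (geomPoints W) ℓ}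
    (he : e ∈ (rationalTateGaloisRepOf (geomPoints W) ℓ h).fixedSubmodule
      (𝔓.inertia (absoluteGaloisGroup K))) :
    rationalTateRepresentation (absoluteGaloisGroup K) (geomPoints W) ℓ σ e =
      (v.residueCard : ℚ_[ℓ]) • e := by
  have hBF : W.serreTate_frobenius_smul_torsion_of_hasSplitMultiplicativeReductionAt ℓ := by
    intro _ v hℓ hv 𝔓 h𝔓
    obtain ⟨c, hc, h⟩ := W.smul_nsmul_torsion_of_hasMultiplicativeReductionAt_of_kodairaNeron_at ℓ
      (W.kodairaNeron_exists_finset_reducesToNonsingular_of_hasMultiplicativeReductionAt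
        hv.hasMultiplicativeReductionAt) hℓ hv.hasMultiplicativeReductionAt h𝔓
    exact ⟨c, hc, fun σ hσ n P hP hPn ↦ (h hσ n P hP hPn).1 hv⟩
  exact W.frobenius_smul_fixedSubmodule_inertia_rationalTate_of_hasSplitMultiplicativeReductionAt_of_frobenius_torsion
    ℓ hBF h hℓ hv h𝔓 hσ he

end WeierstrassCurve

/-! ### From Frobenius elements to the decomposition group -/

namespace Literature.NumberTheory.GaloisRepresentations

variable {K : Type u} [Field K] [NumberField K]

/-- **A closed submonoid of `Γ_K` containing `I_𝔓` and one arithmetic Frobenius at `𝔓` contains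
the decomposition group `D_𝔓`** (`D_𝔓/I_𝔓 ≅ Gal(k̄_v/k_v)` is topologically generated by
Frobenius: Neukirch, *Algebraic Number Theory*, I §9 (9.4)–(9.5); Serre, *Local Fields*, I §8).
Let `S ⊆ Γ_K` be closed, closed under products, with `1 ∈ S`, `I_𝔓 ⊆ S` and `φ ∈ S` for an
arithmetic Frobenius `φ` at `𝔓 ∣ v`; then `D_𝔓 ⊆ S`.  Proof: by
`exists_eq_frobenius_pow_mul_of_mem_decompositionSubgroup` (`FrobeniusGeneration`), for every open
subgroup `U` every `d ∈ D_𝔓` is `φⁿ · i · u` with `i ∈ I_𝔓`, `u ∈ U`, so `d · u⁻¹ ∈ S`; the cosets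
`d · Gal(K̄/E)`, `E/K` finite, form a neighbourhood basis of `d` (Krull topology,
`krullTopology_mem_nhds_one_iff`), whence `d ∈ \bar S = S`.
[cite: NeukirchANT1999, Ch. I §9 Prop. (9.4)–(9.5)] -/
theorem decompositionSubgroup_subset_of_isClosed_of_frobenius_mem {v : HeightOneSpectrum (𝓞 K)}
    {𝔓 : Ideal (absIntegers (𝓞 K) K)} (h𝔓 : 𝔓 ∈ v.primesAbove) {φ : absoluteGaloisGroup K}
    (hφ : IsArithFrobAt (𝓞 K) φ 𝔓) {S : Set (absoluteGaloisGroup K)} (hS : IsClosed S)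
    (hone : (1 : absoluteGaloisGroup K) ∈ S) (hmul : ∀ g ∈ S, ∀ g' ∈ S, g * g' ∈ S)
    (hI : ∀ i ∈ 𝔓.inertia (absoluteGaloisGroup K), i ∈ S) (hφS : φ ∈ S) :
    ((𝔓.decompositionSubgroup (absoluteGaloisGroup K) : Subgroup (absoluteGaloisGroup K)) :
      Set (absoluteGaloisGroup K)) ⊆ S := by
  intro d hd
  have hφnS : ∀ n : ℕ, φ ^ n ∈ S := fun n ↦ by
    induction n with
    | zero => rw [pow_zero]; exact hone
    | succ n ih => rw [pow_succ]; exact hmul _ ih _ hφS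
  rw [← hS.closure_eq, mem_closure_iff_nhds]
  intro N hN
  have hN1 : (fun τ : absoluteGaloisGroup K ↦ d * τ) ⁻¹' N ∈ 𝓝 (1 : absoluteGaloisGroup K) :=
    (continuous_const_mul d).continuousAt.preimage_mem_nhds (by rwa [mul_one])
  obtain ⟨E, hfin, hE⟩ := (krullTopology_mem_nhds_one_iff K (AlgebraicClosure K) _).1 hN1
  haveI := hfin
  obtain ⟨n, i, u, hi, hu, hdec⟩ := exists_eq_frobenius_pow_mul_of_mem_decompositionSubgroup h𝔓 hφ
    (U := E.fixingSubgroup) (IntermediateField.fixingSubgroup_isOpen E) hd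
  have hmemN : d * u⁻¹ ∈ N := hE (E.fixingSubgroup.inv_mem hu)
  have heq : d * u⁻¹ = φ ^ n * i := by rw [hdec, mul_inv_cancel_right]
  rw [heq] at hmemN
  exact ⟨φ ^ n * i, hmemN, hmul _ (hφnS n) _ (hI i hi)⟩

/-- **A character read off Frobenius and inertia is the eigenvalue on all of `D_𝔓`.**  Let `ρ` be
a representation of `Γ_K` on a Hausdorff topological module `V` over a topological semiring `k`
with `g ↦ ρ(g) e` continuous, `χ : Γ_K →* k` a continuous character, and suppose `ρ(i) e = e`,
`χ(i) = 1` for `i ∈ I_𝔓` and `ρ(φ) e = χ(φ) e` for one arithmetic Frobenius `φ` at `𝔓 ∣ v`.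
Then `ρ(σ) e = χ(σ) e` for every `σ ∈ D_𝔓`: the set `{g | ρ(g) e = χ(g) e}` is a closed submonoid
containing `I_𝔓` and `φ` (`decompositionSubgroup_subset_of_isClosed_of_frobenius_mem`).  (The
Galois-theoretic form of "an unramified-twisted eigenline of `D_𝔓` is determined by Frobenius";
Serre, *Abelian `ℓ`-adic representations*, I §2.1.) [folklore] -/
theorem apply_eq_smul_of_mem_decompositionSubgroup_of_frobenius {k : Type*} [CommSemiring k]
    [TopologicalSpace k] {V : Type*} [AddCommMonoid V] [Module k V] [TopologicalSpace V]
    [T2Space V] [ContinuousSMul k V] {v : HeightOneSpectrum (𝓞 K)}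
    {𝔓 : Ideal (absIntegers (𝓞 K) K)} (h𝔓 : 𝔓 ∈ v.primesAbove)
    (ρ : Representation k (absoluteGaloisGroup K) V) (χ : absoluteGaloisGroup K →* k) (e : V)
    (hρ : Continuous fun g ↦ ρ g e) (hχ : Continuous χ)
    (hIρ : ∀ i ∈ 𝔓.inertia (absoluteGaloisGroup K), ρ i e = e)
    (hIχ : ∀ i ∈ 𝔓.inertia (absoluteGaloisGroup K), χ i = 1)
    {φ : absoluteGaloisGroup K} (hφ : IsArithFrobAt (𝓞 K) φ 𝔓) (hφe : ρ φ e = χ φ • e)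
    {σ : absoluteGaloisGroup K} (hσ : σ ∈ 𝔓.decompositionSubgroup (absoluteGaloisGroup K)) :
    ρ σ e = χ σ • e := by
  refine decompositionSubgroup_subset_of_isClosed_of_frobenius_mem h𝔓 hφ
    (S := {g | ρ g e = χ g • e}) (isClosed_eq hρ (hχ.smul continuous_const)) ?_ ?_ ?_ hφe hσ
  · simp only [Set.mem_setOf_eq, map_one, Module.End.one_apply, one_smul]
  · intro g hg g' hg'
    simp only [Set.mem_setOf_eq] at hg hg' ⊢
    rw [map_mul, Module.End.mul_apply, hg', map_smul, hg, smul_smul, map_mul, mul_comm]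
  · intro i hi
    simp only [Set.mem_setOf_eq, hIρ i hi, hIχ i hi, one_smul]

end Literature.NumberTheory.GaloisRepresentations

namespace WeierstrassCurve

open Literature.NumberTheory.EllipticCurves Literature.NumberTheory.GaloisRepresentations

variable {K : Type u} [Field K] [NumberField K] (W : WeierstrassCurve K) (ℓ : ℕ) [Fact ℓ.Prime]

/-! ### The discharge -/

/-- **Split multiplicative reduction: `D_𝔓` acts on the line `(V_ℓ E)^{I_𝔓}` through the
cyclotomic character — discharged.**  The named fact
`smul_fixedSubmodule_inertia_rationalTate_of_hasSplitMultiplicativeReductionAt W ℓ` of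
`HasseWeilAbelianEulerFactorElliptic` holds: for an elliptic curve `E/K` over a number field with
split multiplicative reduction at the finite place `v ∤ ℓ`, a prime `𝔓 ∣ v` of `\bar ℤ_K`, every
`σ ∈ D_𝔓` and every `e ∈ (V_ℓ E)^{I_𝔓}`, `σ e = χ_ℓ(σ) e`.  Printed source: Silverman, *ATAEC*,
Exercise 5.13(a),(b) (PDF p. 416) — for `E/K_v` with split multiplicative reduction,
`1 → T_ℓ(μ) → T_ℓ(E) → ℤ_ℓ → 0` is exact as `G_{K̄_v/K_v}`-modules and the inertia group acts
through `(1 b; 0 1)`, so `T_ℓ(E)^{I} = T_ℓ(μ)` carries the cyclotomic action of the whole local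
Galois group (`= D_𝔓`); Serre–Tate, §1 Lemma 2 (the reduction isomorphism
`A_m^I ≅ Ã_m` *"commutes with the action of `D(v̄)`"*), `Ã⁰ = Ẽ_ns ≅ 𝔾_m` over `k_v`.  Proof:
on the Frobenius elements of `D_𝔓` this is the theorem
`frobenius_smul_fixedSubmodule_inertia_rationalTate_of_hasSplitMultiplicativeReductionAt`
(`N v = χ_ℓ(Frob)` in `ℤ_ℓ`, from the congruences modulo every `ℓⁿ`,
`GaloisRep.toZModPow_cyclotomicCharacter_of_isArithFrobAt`, Serre I.1.2); on
`I_𝔓` both sides are `e` (`GaloisRep.cyclotomicCharacter_eq_one_of_mem_inertia`); the Galois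
action on `V_ℓ E ≅ ℚ_ℓ²` (Hausdorff for its module topology) and `χ_ℓ` are continuous, so
`apply_eq_smul_of_mem_decompositionSubgroup_of_frobenius` (`D_𝔓` lies in the closed submonoid
generated by `I_𝔓` and a Frobenius, Neukirch I §9 (9.4)–(9.5)) concludes.
[cite: SilvermanATAEC1994, Exercise 5.13(a),(b) (PDF p. 416), with Thm. V.5.3 (PDF p. 407)]
[cite: SerreTate1968, §1 Lemma 2 (p. 495)]
[cite: NeukirchANT1999, Ch. I §9 Prop. (9.4)–(9.5)] -/
theorem smul_fixedSubmodule_inertia_rationalTate_of_hasSplitMultiplicativeReductionAt_holds :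
    W.smul_fixedSubmodule_inertia_rationalTate_of_hasSplitMultiplicativeReductionAt ℓ := by
  intro _ h v hℓ hv 𝔓 h𝔓 σ e he
  haveI : 𝔓.IsPrime := h𝔓.1
  -- `V_ℓ E` is Hausdorff (finite-dimensional with its module topology over `ℚ_ℓ`)
  haveI : Module.Finite ℚ_[ℓ] (RationalTateModule (geomPoints W) ℓ) := W.finite_rationalTateModule ℓ
  haveI : ContinuousAdd (RationalTateModule (geomPoints W) ℓ) :=
    IsModuleTopology.toContinuousAdd ℚ_[ℓ] _
  haveI : T2Space (RationalTateModule (geomPoints W) ℓ) := by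
    let b := Module.finBasis ℚ_[ℓ] (RationalTateModule (geomPoints W) ℓ)
    exact T2Space.of_injective_continuous b.equivFun.injective
      (IsModuleTopology.continuous_of_linearMap b.equivFun.toLinearMap)
  -- the cyclotomic character with values in `ℚ_ℓ`
  let χ : absoluteGaloisGroup K →* ℚ_[ℓ] :=
    (PadicInt.Coe.ringHom (p := ℓ)).toMonoidHom.comp
      ((Units.coeHom ℤ_[ℓ]).comp (GaloisRep.cyclotomicCharacter K ℓ).toMonoidHom)
  have hχapply : ∀ g : absoluteGaloisGroup K,
      χ g = (((GaloisRep.cyclotomicCharacter K ℓ g : ℤ_[ℓ]ˣ) : ℤ_[ℓ]) : ℚ_[ℓ]) := fun _ ↦ rfl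
  have hχcont : Continuous χ := by
    have hc : Continuous (PadicInt.Coe.ringHom (p := ℓ)) :=
      AddMonoidHomClass.continuous_of_bound _ 1 fun x ↦ by
        rw [one_mul]
        exact (PadicInt.norm_def (z := x)).symm.le
    exact hc.comp (Units.continuous_val.comp (GaloisRep.cyclotomicCharacter K ℓ).continuous)
  obtain ⟨φ, hφ⟩ := HeightOneSpectrum.exists_isArithFrobAt_of_mem_primesAbove_holds h𝔓
  rw [← hχapply]
  refine apply_eq_smul_of_mem_decompositionSubgroup_of_frobenius h𝔓
    (rationalTateRepresentation (absoluteGaloisGroup K) (geomPoints W) ℓ) χ e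
    (h.comp₂ continuous_id continuous_const) hχcont
    ((ContinuousRep.mem_fixedSubmodule _ _ e).mp he) (fun i hi ↦ ?_) hφ ?_ σ.2
  · rw [hχapply, GaloisRep.cyclotomicCharacter_eq_one_of_mem_inertia ℓ hℓ h𝔓 hi, Units.val_one,
      PadicInt.coe_one]
  · -- `χ_ℓ(φ) = N v` in `ℤ_ℓ` (Serre I.1.2), from the congruences modulo every `ℓⁿ`
    have hχφ : ((GaloisRep.cyclotomicCharacter K ℓ φ : ℤ_[ℓ]ˣ) : ℤ_[ℓ]) = (v.residueCard : ℤ_[ℓ]) :=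
      PadicInt.ext_of_toZModPow.mp fun n ↦ by
        rw [GaloisRep.toZModPow_cyclotomicCharacter_of_isArithFrobAt ℓ hℓ h𝔓 hφ n, map_natCast]
    rw [W.frobenius_smul_fixedSubmodule_inertia_rationalTate_of_hasSplitMultiplicativeReductionAt ℓ
      h hℓ hv h𝔓 hφ he, hχapply, hχφ, PadicInt.coe_natCast]

/-! ### Consequence: the split bad-place fact of `HasseWeilAbelianBadReduction` -/

/-- **Split multiplicative reduction: `(V_ℓ E)_{I_𝔓}` is a line with trivial `D_𝔓`-action —
discharged.**  The named fact `inertiaCoinvariants_rationalTate_of_hasSplitMultiplicativeReductionAt W ℓ`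
of `HasseWeilAbelianBadReduction` (for an elliptic curve `E/K` over a number field with split
multiplicative reduction at `v ∤ ℓ` and `𝔓 ∣ v`: `dim (V_ℓ E)_{I_𝔓} = 1` and every `σ ∈ D_𝔓`
acts on it trivially; the Galois side of `L_v(E, T) = 1 - T`, Silverman, *AEC*, C.§16, PDF
p. 390) holds: `codim (V_ℓ E)^{I_𝔓} = 1` at the multiplicative places is the theorem
`codimFixed_inertia_rationalTate_eq_one_of_hasMultiplicativeReductionAt_holds` (*ATAEC*
Thm. IV.10.2(a), multiplicative case, `InertiaInvariantsMultiplicativeProofs`), `D_𝔓` acts on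
`(V_ℓ E)^{I_𝔓}` through `χ_ℓ`
(`smul_fixedSubmodule_inertia_rationalTate_of_hasSplitMultiplicativeReductionAt_holds`), and
`det ρ_{E,ℓ} = χ_ℓ` gives the trivial action on the quotient line
(`inertiaCoinvariants_rationalTate_of_hasSplitMultiplicativeReductionAt_of_codim_of_cyclotomic`,
`HasseWeilAbelianEulerFactorElliptic`).
[cite: SilvermanATAEC1994, Thm. IV.10.2(a) and Exercise 5.13(a),(b) (PDF pp. 358, 416)]
[cite: SilvermanAEC2009, §C.16 (PDF p. 390)] -/
theorem inertiaCoinvariants_rationalTate_of_hasSplitMultiplicativeReductionAt_holds :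
    W.inertiaCoinvariants_rationalTate_of_hasSplitMultiplicativeReductionAt ℓ :=
  W.inertiaCoinvariants_rationalTate_of_hasSplitMultiplicativeReductionAt_of_codim_of_cyclotomic ℓ
    (W.codimFixed_inertia_rationalTate_eq_one_of_hasMultiplicativeReductionAt_holds ℓ)
    (W.smul_fixedSubmodule_inertia_rationalTate_of_hasSplitMultiplicativeReductionAt_holds ℓ)

end WeierstrassCurve

end
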